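import Summits.CriticalPhenomena.PercolationContinuityZ3.Theorems.PercNearOneGluingNoHeavyRsw3SlabSpanningClusters
import HarnessLib

/-!
# Aizenman's Theorem 1 (quantitative half) for bond percolation on `ℤ³`: thin slab-boxes are crossed the short way
# with probability `≥ 1 - (1-c)^{j²}`, `j ≈ 1/(3t)`, uniformly in the scale

builds on p205010 (kernel theorem, internal audit signed; external expert review pending)

RSW3 lane (LANE 3), seat `prim-rsw3-p2` (gen 3). Helper file for the crux `stmt-CriticalPhenomena-4575` (`--supports`).
No definitions, no named facts, no sorries.  Notation (`Cross_n`) as in `…Rsw3SlabBlocks.lean`.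

M. Aizenman, Nucl. Phys. B 485 (1997), Thm. 1: at `p_c`, for every `L`, `R_{L,t} = P(S_{L,t} = [0,tL]×[0,L]^{d-1}` is
spanned in the short direction`) ≥ h_d(t)` with `h_d(t) ≥ 1 - A e^{-const·t^{-(d-1)}}` as `t ↘ 0` ("standard", App. B:
the slab contains `≍ t^{-(d-1)}` disjoint translates of a fixed-aspect block, each crossed independently with probability
bounded below).  The positivity half (`h_d(t) > 0` for `t < 1/2`) is the lane's `Crossing.EasyCrossingLowerBound k`,
`k ≥ 2` (p208904, p208907; Kesten's sponge bound).  This file adds the RATE for `d = 3`: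

* `real_compl_slabCross_le_pow_sq` — for any `p`: if `c ≤ P_p({0..n}×{0..2n}² crossed the short way)` and
  `j (2n+1) ≤ w + 1`, then `P_p({0..n}×{0..w}² not spanned in direction 0) ≤ (1 - c)^{j²}` (a `j × j` grid of disjoint
  `1:2:2` sub-blocks; independence over disjoint edge sets; translation invariance);
* `le_real_boxCross_of_real_slabCross` — the `inConn` spanning event implies Kesten's `boxCross` (everywhere);
* `one_sub_pow_le_real_boxCross_easyShape_criticalProbI` — **at `p_c(ℤ³)`, for all `k` and `n ≥ 1`:
  `P(boxCross (easyShape k n) 0) ≥ 1 - (1 - c)^{⌊k/3⌋²}`** with the constant `c ∈ (0,1]` of `EasyCrossingLowerBound 2`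
  — i.e. `h_3(1/k) ≥ 1 - exp(-c' k²)`, Aizenman's `t^{-(d-1)} = t^{-2}` rate.

References: M. Aizenman, Nucl. Phys. B 485 (1997) 551–582, §2 Thm. 1 and App. B [Aizenman1997]; H. Kesten,
*Percolation Theory for Mathematicians* (1982), Thm. 5.1 [Kesten1982].
-/

noncomputable section

namespace Summit.CriticalPhenomena.PercolationContinuityZ3.Theorems.Rsw3

open MeasureTheory Literature.Probability.LatticeModels Literature.Probability.Percolation
open Literature.Probability.Percolation.KestenZhang SimpleGraph Relation
open Summit.CriticalPhenomena.PercolationContinuityZ3.Theorems.Crossing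

/-- **Thin cells are spanned with overwhelming probability, `j × j` grid form** (Aizenman 1997 Thm. 1, rate
`t^{-(d-1)}`, `d = 3`): if the `1:2:2` block `{0..n}×{0..2n}²` is crossed the short way with probability `≥ c` at density
`p` and `j (2n+1) ≤ w + 1`, then `P_p({0..n}×{0..w}² is not spanned in direction 0) ≤ (1 - c)^{j²}`: the cell contains the
`j²` pairwise disjoint translates `{0..n}×{0..2n}² + (0, i(2n+1), i'(2n+1))`, `i, i' < j`, whose crossing events are
independent and each imply the spanning of the cell. [cite: Aizenman1997, §2 Thm. 1 and App. B (h_d(t) ≥ 1 - A exp(-const t^{-(d-1)}))] -/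
theorem real_compl_slabCross_le_pow_sq (p : unitInterval) {n w j : ℕ} {c : ℝ}
    (hc : c ≤ (bondPercolation (zdGraph 3) p).real (boxCross ![(n : ℤ), ((2 * n : ℕ) : ℤ), ((2 * n : ℕ) : ℤ)] 0))
    (hw : j * (2 * n + 1) ≤ w + 1) :
    (bondPercolation (zdGraph 3) p).real
        {ω : BondConfig (Site 3) | ∃ x ∈ Finset.Icc (0 : Site 3) ![(n : ℤ), w, w], ∃ y ∈ Finset.Icc (0 : Site 3) ![(n : ℤ), w, w],
          x 0 = 0 ∧ y 0 = (n : ℤ) ∧ ω ∈ inConn ↑(Finset.Icc (0 : Site 3) ![(n : ℤ), w, w]) x y}ᶜ ≤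
      (1 - c) ^ (j ^ 2) := by
  classical
  set μ := bondPercolation (zdGraph 3) p with hμ
  set C : Finset (Site 3) := Finset.Icc (0 : Site 3) ![(n : ℤ), w, w] with hC
  set Q₀ : Finset (Site 3) := Finset.Icc (0 : Site 3) ![(n : ℤ), ((2 * n : ℕ) : ℤ), ((2 * n : ℕ) : ℤ)] with hQ₀
  set v : ℕ × ℕ → Site 3 := fun i => ![0, (i.1 : ℤ) * (2 * n + 1), (i.2 : ℤ) * (2 * n + 1)] with hv
  set T : Finset (ℕ × ℕ) := Finset.range j ×ˢ Finset.range j with hT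
  have hv0 : ∀ i, v i 0 = 0 := fun i => by simp [hv]
  have hw' : (j : ℤ) * (2 * n + 1) ≤ w + 1 := by exact_mod_cast hw
  have hn0 : (0 : ℤ) ≤ n := by positivity
  -- one coordinate of a sub-block
  have coord : ∀ {i : ℕ} {t : ℤ}, i < j → (i : ℤ) * (2 * n + 1) ≤ t → t ≤ ((2 * n : ℕ) : ℤ) + (i : ℤ) * (2 * n + 1) →
      0 ≤ t ∧ t ≤ w := by
    intro i t hij h1 h2
    have hi1 : (i : ℤ) + 1 ≤ j := by exact_mod_cast hij
    have hprod := mul_le_mul_of_nonneg_right hi1 (show (0 : ℤ) ≤ 2 * (n : ℤ) + 1 by positivity)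
    push_cast at h2
    constructor <;> nlinarith
  -- the sub-blocks lie in the cell
  have hQC : ∀ i ∈ T, Q₀.image (· + v i) ⊆ C := by
    intro i hi x hx
    rw [hT, Finset.mem_product, Finset.mem_range, Finset.mem_range] at hi
    rw [hQ₀, mem_image_Icc_add_iff] at hx
    rw [hC, Finset.mem_Icc]
    have h0 := hx 0; have h1 := hx 1; have h2 := hx 2
    simp only [hv] at h0 h1 h2
    simp at h0 h1 h2
    have c1 := coord hi.1 h1.1 (by simpa using h1.2)
    have c2 := coord hi.2 h2.1 (by simpa using h2.2)
    refine ⟨fun k => ?_, fun k => ?_⟩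
    · fin_cases k <;> simp
      · exact h0.1
      · exact c1.1
      · exact c2.1
    · fin_cases k <;> simp
      · exact h0.2
      · exact c1.2
      · exact c2.2
  -- complement of the cell spanning event ⊆ ⋂ complements of the sub-block crossing events
  have hsub : {ω : BondConfig (Site 3) | ∃ x ∈ C, ∃ y ∈ C, x 0 = 0 ∧ y 0 = (n : ℤ) ∧ ω ∈ inConn ↑C x y}ᶜ ⊆
      ⋂ i ∈ T, {ω : BondConfig (Site 3) | ∃ x ∈ Q₀.image (· + v i), ∃ y ∈ Q₀.image (· + v i),
        x 0 = 0 ∧ y 0 = (n : ℤ) ∧ ω ∈ inConn ↑(Q₀.image (· + v i)) x y}ᶜ := by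
    intro ω hω
    simp only [Set.mem_iInter, Set.mem_compl_iff]
    intro i hi hQ
    apply hω
    obtain ⟨x, hx, y, hy, hx0, hy0, hconn⟩ := hQ
    exact ⟨x, hQC i hi hx, y, hQC i hi hy, hx0, hy0, inConn_mono (Finset.coe_subset.2 (hQC i hi)) _ _ hconn⟩
  -- independence of the sub-block events
  have hdet : ∀ i ∈ T, DeterminedBy
      {ω : BondConfig (Site 3) | ∃ x ∈ Q₀.image (· + v i), ∃ y ∈ Q₀.image (· + v i),
        x 0 = 0 ∧ y 0 = (n : ℤ) ∧ ω ∈ inConn ↑(Q₀.image (· + v i)) x y}ᶜ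
      (↑(edgesIn (zdGraph 3) (Q₀.image (· + v i))) : Set (Sym2 (Site 3))) := fun i _ =>
    (determinedBy_slabCross n (Q₀.image (· + v i))).compl'
  -- disjointness along one coordinate
  have sep : ∀ {a b : ℕ} {t : ℤ}, a < b → t ≤ ((2 * n : ℕ) : ℤ) + (a : ℤ) * (2 * n + 1) →
      (b : ℤ) * (2 * n + 1) ≤ t → False := by
    intro a b t hab h1 h2
    have hi1 : (a : ℤ) + 1 ≤ b := by exact_mod_cast hab
    have hprod := mul_le_mul_of_nonneg_right hi1 (show (0 : ℤ) ≤ 2 * (n : ℤ) + 1 by positivity)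
    push_cast at h1
    nlinarith
  have hdisjQ : ∀ i i' : ℕ × ℕ, i ≠ i' → Disjoint (Q₀.image (· + v i)) (Q₀.image (· + v i')) := by
    intro i i' hne
    rw [Finset.disjoint_left]
    intro x hx hx'
    rw [hQ₀, mem_image_Icc_add_iff] at hx hx'
    have h1 := hx 1; have h1' := hx' 1; have h2 := hx 2; have h2' := hx' 2
    simp only [hv] at h1 h1' h2 h2'
    simp at h1 h1' h2 h2'
    have hne' : ¬(i.1 = i'.1 ∧ i.2 = i'.2) := fun h => hne (Prod.ext h.1 h.2)
    by_cases h₁ : i.1 = i'.1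
    · have h₂ : i.2 ≠ i'.2 := fun h => hne' ⟨h₁, h⟩
      rcases lt_or_gt_of_ne h₂ with hlt | hlt
      · exact sep hlt (by simpa using h2.2) h2'.1
      · exact sep hlt (by simpa using h2'.2) h2.1
    · rcases lt_or_gt_of_ne h₁ with hlt | hlt
      · exact sep hlt (by simpa using h1.2) h1'.1
      · exact sep hlt (by simpa using h1'.2) h1.1
  have hdisj : (↑T : Set (ℕ × ℕ)).PairwiseDisjoint
      (fun i => (↑(edgesIn (zdGraph 3) (Q₀.image (· + v i))) : Set (Sym2 (Site 3)))) :=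
    fun i _ i' _ hne => disjoint_edgesIn_of_disjoint (hdisjQ i i' hne)
  have hprod := bondPercolation_real_biInter_eq_prod (zdGraph 3) p T _ _ hdet
    (fun i hi => (hdet i hi).measurableSet_of_finset) hdisj
  -- each factor is at most `1 - c`
  have hfac : ∀ i ∈ T, μ.real
      {ω : BondConfig (Site 3) | ∃ x ∈ Q₀.image (· + v i), ∃ y ∈ Q₀.image (· + v i),
        x 0 = 0 ∧ y 0 = (n : ℤ) ∧ ω ∈ inConn ↑(Q₀.image (· + v i)) x y}ᶜ ≤ 1 - c := by
    intro i _
    have hmeas : MeasurableSet {ω : BondConfig (Site 3) | ∃ x ∈ Q₀.image (· + v i), ∃ y ∈ Q₀.image (· + v i),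
        x 0 = 0 ∧ y 0 = (n : ℤ) ∧ ω ∈ inConn ↑(Q₀.image (· + v i)) x y} :=
      (determinedBy_slabCross n (Q₀.image (· + v i))).measurableSet_of_finset
    rw [measureReal_compl hmeas, probReal_univ]
    have htrans : μ.real {ω : BondConfig (Site 3) | ∃ x ∈ Q₀.image (· + v i), ∃ y ∈ Q₀.image (· + v i),
        x 0 = 0 ∧ y 0 = (n : ℤ) ∧ ω ∈ inConn ↑(Q₀.image (· + v i)) x y} =
        μ.real {ω : BondConfig (Site 3) | ∃ x ∈ Q₀, ∃ y ∈ Q₀, x 0 = 0 ∧ y 0 = (n : ℤ) ∧ ω ∈ inConn ↑Q₀ x y} := by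
      rw [hμ, ← bondPercolation_real_preimage_relabel_iso (zdShiftIso (v i)) p, preimage_relabel_slabCross n Q₀ (hv0 i)]
    have hQ : c ≤ μ.real {ω : BondConfig (Site 3) | ∃ x ∈ Q₀, ∃ y ∈ Q₀, x 0 = 0 ∧ y 0 = (n : ℤ) ∧ ω ∈ inConn ↑Q₀ x y} := by
      refine hc.trans ?_
      have h := real_boxCross_le_real_slabCross p ![(n : ℤ), ((2 * n : ℕ) : ℤ), ((2 * n : ℕ) : ℤ)]
      simpa [hQ₀] using h
    linarith
  calc μ.real {ω : BondConfig (Site 3) | ∃ x ∈ C, ∃ y ∈ C, x 0 = 0 ∧ y 0 = (n : ℤ) ∧ ω ∈ inConn ↑C x y}ᶜ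
      ≤ μ.real (⋂ i ∈ T, {ω : BondConfig (Site 3) | ∃ x ∈ Q₀.image (· + v i), ∃ y ∈ Q₀.image (· + v i),
          x 0 = 0 ∧ y 0 = (n : ℤ) ∧ ω ∈ inConn ↑(Q₀.image (· + v i)) x y}ᶜ) :=
        measureReal_mono hsub (measure_ne_top _ _)
    _ = ∏ i ∈ T, μ.real {ω : BondConfig (Site 3) | ∃ x ∈ Q₀.image (· + v i), ∃ y ∈ Q₀.image (· + v i),
          x 0 = 0 ∧ y 0 = (n : ℤ) ∧ ω ∈ inConn ↑(Q₀.image (· + v i)) x y}ᶜ := hprod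
    _ ≤ ∏ _i ∈ T, (1 - c) := Finset.prod_le_prod (fun i _ => measureReal_nonneg) hfac
    _ = (1 - c) ^ (j ^ 2) := by rw [Finset.prod_const, hT, Finset.card_product, Finset.card_range, sq]

/-- The `inConn` spanning event of `{0..L}` implies Kesten's crossing event `boxCross L 0` (an open lattice path inside the
block is an open path of the induced open graph); hence `P_p(Cross_{L₀}({0..L})) ≤ P_p(boxCross L 0)`.
[cite: Kesten1982, §3.3 Def. 1–3 (i-crossings)] -/
theorem le_real_boxCross_of_real_slabCross (p : unitInterval) (L : Site 3) :
    (bondPercolation (zdGraph 3) p).real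
        {ω : BondConfig (Site 3) | ∃ x ∈ Finset.Icc (0 : Site 3) L, ∃ y ∈ Finset.Icc (0 : Site 3) L,
          x 0 = 0 ∧ y 0 = L 0 ∧ ω ∈ inConn ↑(Finset.Icc (0 : Site 3) L) x y} ≤
      (bondPercolation (zdGraph 3) p).real (boxCross L 0) := by
  refine measureReal_mono ?_ (measure_ne_top _ _)
  rintro ω ⟨x, hx, y, hy, hx0, hyL, hconn⟩
  exact ⟨x, hx, y, hy, hx0, hyL, mem_openConnIn_of_mem_inConn hx hconn⟩

/-- **Aizenman's Theorem 1, quantitative half, for bond percolation on `ℤ³`**: with the constant `c ∈ (0,1]` of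
`Crossing.EasyCrossingLowerBound 2` (the lane's kernel theorem `easyCrossingLowerBound_two`), for every `k` and every
`n ≥ 1` the slab-box `{0..n}×{0..kn}²` is crossed the short way at `p_c(ℤ³)` with probability
`≥ 1 - (1 - c)^{⌊k/3⌋²}`: `R_{L,t} ≥ 1 - exp(-c' t^{-2})` uniformly in `L`, i.e. `h_3(t) → 1` at Aizenman's rate
`t^{-(d-1)}`.  (`⌊k/3⌋ (2n+1) ≤ kn + 1` for `n ≥ 1`.) [cite: Aizenman1997, §2 Thm. 1 (h_d(t) ≥ 1 - A exp(-const·t^{-(d-1)}))] -/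
theorem one_sub_pow_le_real_boxCross_easyShape_criticalProbI :
    ∃ c : ℝ, 0 < c ∧ c ≤ 1 ∧ ∀ k n : ℕ, 1 ≤ n →
      1 - (1 - c) ^ ((k / 3) ^ 2) ≤ (bondPercolation (zdGraph 3) (criticalProbI 3)).real (boxCross (easyShape k n) 0) := by
  obtain ⟨c, hc, hcross⟩ := easyCrossingLowerBound_two
  have hc1 : c ≤ 1 := (hcross 1 le_rfl).trans measureReal_le_one
  refine ⟨c, hc, hc1, fun k n hn => ?_⟩
  have hc' : c ≤ (bondPercolation (zdGraph 3) (criticalProbI 3)).real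
      (boxCross ![(n : ℤ), ((2 * n : ℕ) : ℤ), ((2 * n : ℕ) : ℤ)] 0) := by
    have h := hcross n hn
    have e : easyShape 2 n = ![(n : ℤ), ((2 * n : ℕ) : ℤ), ((2 * n : ℕ) : ℤ)] := by
      simp only [easyShape]; push_cast; rfl
    rw [e] at h; exact h
  have hw : (k / 3) * (2 * n + 1) ≤ k * n + 1 := by
    have h3 : 3 * (k / 3) ≤ k := Nat.mul_div_le k 3
    generalize hq : k / 3 = q at h3 ⊢
    nlinarith
  have hboost := real_compl_slabCross_le_pow_sq (criticalProbI 3) (w := k * n) hc' hw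
  have e : easyShape k n = ![(n : ℤ), ((k * n : ℕ) : ℤ), ((k * n : ℕ) : ℤ)] := by
    simp only [easyShape]; push_cast; rfl
  rw [e]
  have hle := le_real_boxCross_of_real_slabCross (criticalProbI 3) ![(n : ℤ), ((k * n : ℕ) : ℤ), ((k * n : ℕ) : ℤ)]
  simp only [Matrix.cons_val_zero] at hle
  have hmeas : MeasurableSet {ω : BondConfig (Site 3) | ∃ x ∈ Finset.Icc (0 : Site 3) ![(n : ℤ), ((k * n : ℕ) : ℤ), ((k * n : ℕ) : ℤ)],
      ∃ y ∈ Finset.Icc (0 : Site 3) ![(n : ℤ), ((k * n : ℕ) : ℤ), ((k * n : ℕ) : ℤ)],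
      x 0 = 0 ∧ y 0 = (n : ℤ) ∧ ω ∈ inConn ↑(Finset.Icc (0 : Site 3) ![(n : ℤ), ((k * n : ℕ) : ℤ), ((k * n : ℕ) : ℤ)]) x y} :=
    (determinedBy_slabCross n _).measurableSet_of_finset
  have hcompl := measureReal_compl (μ := bondPercolation (zdGraph 3) (criticalProbI 3)) hmeas
  rw [probReal_univ] at hcompl
  linarith

end Summit.CriticalPhenomena.PercolationContinuityZ3.Theorems.Rsw3

end
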